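import Summits.BirchSwinnertonDyer.Rank1Residual.Additive.CensusX42HeightRescaling
import HarnessLib

/-!
# Rescaling the `p`-adic height datum, II: the EXACT census relation pins `Reg_p(E, Dh)`, the WINDOW
# relation pins only `‖Reg_p(E, Dh)‖` — and what the `∀ Dh` packaging adds at window grade
# (cell `b2b-bsdres`, census cell `bsd-formula-census`, seat `b2b-bsdres-census-ctyper1` =
# conjecture-typer 1, gen 8; prequel `CensusX42HeightRescaling.lean`, sequel `CensusX42ForallErratum.lean`)

HONEST FRAMING (cell `b2b-bsdres`, run/shared/lean/b2b/bsd-rank1-residual/, verbatim in every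
file): the goal of the cell is to DELETE the COMBINATION-SHAPED residual classes of the
Birch–Swinnerton-Dyer formula for ALL analytic-rank `≤ 1` elliptic curves over `ℚ` — "full BSD
formula for every rank `≤ 1` curve in class `C`" assembled STRICTLY from published theorems — so
that the rank-`≤ 1` remainder becomes exactly the CONSTRUCTION-SHAPED classes, which are TYPED
(missing-input `Prop`s), NOT attempted. This is not "finishing BSD". Census cell
(bsd-formula-census): research instrumentation; census output = EVIDENCE / conjecture items, never a
Literature fact; labels / RESIDUAL-MAP marks UNCHANGED (O7-ord OPEN; X3♯ / X4♯ CONSTRUCTION-SHAPED);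
nothing booked. Theorems only (no definition, no named fact); named facts enter as HYPOTHESES
(`hGZ`, `hGZK`, `hmodD`).

## What

§1. On a row where the typed X4-2 relation is instantiable — (G-ord, `e = 2`): `TypeGOrd`, `Addv`,
`semistabilityIndex = 2`, or (M): `PotMult`; `r_an = 1`; the good-ordinary / multiplicative twist model,
its newform (`hmodD`) and the period ratio of the right parity are kernel theorems — two height data
`Dh, Dh'` that BOTH satisfy the EXACT census relation `CensusX42.RelationAt W p ·` (gen 2, p252477:
`ϖ·[T¹]L·log_p γ·#T² = u·#Ш_an·Reg_p(E,·)·∏c` with the unit `u = α♭⁻¹(·c_∞(E))` PINNED) have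
`Reg_p(E,Dh) = Reg_p(E,Dh')` (`padicRegulator_eq_of_relationAt_of_relationAt[_mult]`; pointwise form
`…_of_twist_model`): `#Ш_an ≠ 0` (GZ + GZK), `∏c ≠ 0`, `u ≠ 0`, cancel. So the exact relation holds
for AT MOST ONE datum in each unit class `{u·Dh}` with `Reg_p ≠ 0`: at exact grade the SIGN `κ_h` of
the census height versus Delbourgo's regulator (RESIDUAL-MAP §D addenda 9 (2) / 10 (2): `+1` on
(G-ord, `e = 2`), `−1` on (M)) is visible.
§2. Two data that both satisfy the WINDOW relation `CensusX42.ValRelationAt W p ·` (gen 6, p270126)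
have `‖Reg_p(E,Dh)‖ = ‖Reg_p(E,Dh')‖` (`norm_padicRegulator_eq_of_valRelationAt_of_valRelationAt[_mult]`),
and conversely equal norms transfer the relation (prequel, `valRelationAt_of_norm_padicRegulator_eq`):
the window relation is EXACTLY a statement about `ord_p Reg_p(E,Dh)`.
§3. What the packaging `∀ Dh, LeadingTermClauses W p Dh → ValRelationAt W p Dh` (used by the window-
grade `∀ Dh` theorems of `CensusX42ValBridges` / `ValConverse` / `ValLoops`, and of the same shape as
n1011's `hGZ : ∀ Dh, LeadingTermClauses → Schneider ∧ BranchPAdicGrossZagier…`) asserts BEYOND the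
relation for one (B)-datum: the (B)-data of the row form ONE unit class in norm
(`norm_eq_one_of_forall_valRelationAt_of_leadingTermClauses_of_pairing_eq_mul`), in particular `p·Dh`
is never a (B)-datum when `Dh` is (`not_leadingTermClauses_of_forall_valRelationAt_of_pairing_eq_prime_mul`).
Off the anomalous rows (`ReductionNonAnomalous`, every (M) row: Delbourgo's `ℓ = 1`) Theorem (B) with a
non-zero leading coefficient already forces this; on the ANOMALOUS (G-ord) rows, where Delbourgo's
`ℓ_p(E) ∈ {1,p,p²}` is transcribed as `∃ ℓ ∣ p²` (`LeadingTermClauses`, flag `Del02-ThmB-ellp-anomalous`),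
it is an extra `ℓ_p(E)`-shaped rider — recorded here so that consumers choose the pointwise forms when
they want none. Nothing about any curve is asserted; nothing booked.

References: B. Mazur, J. Tate, J. Teitelbaum, Invent. Math. 84 (1986) §I.13, Ch. II §4
[MazurTateTeitelbaum1986Invent]; D. Delbourgo, Compositio Math. 113 (1998) §2.5 BS-D(p) (i)(ii)
[Delbourgo1998]; D. Delbourgo, J. Number Theory 95 (2002) p. 39 (`ℓ_p(E)`), Thm. (B) (p. 40)
[Delbourgo2002]; P. Schneider, Invent. Math. 69 (1982) §1 [Schneider1982PadicHeightI]; B. Gross,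
D. Zagier, Invent. Math. 84 (1986) Thm. I.(7.3) [GrossZagier1986]; HOME RESIDUAL-MAP.md §D addenda 9/10.
-/

set_option autoImplicit false

noncomputable section

open scoped Classical MatrixGroups ModularForm NumberField

open CongruenceSubgroup WeierstrassCurve NumberField Literature.NumberTheory.EllipticCurves
  Literature.NumberTheory.EllipticCurves.ModularForms
  Literature.NumberTheory.EllipticCurves.Rank1Residual
  Literature.NumberTheory.EllipticCurves.Rank1Residual.Typed
  Literature.NumberTheory.EllipticCurves.Delbourgo2002
  Literature.NumberTheory.GaloisRepresentations
  Literature.Barriers.BirchSwinnertonDyer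
  IsDedekindDomain

namespace Summit.BirchSwinnertonDyer.Rank1Residual.Additive

namespace CensusX42

variable {W : WeierstrassCurve ℚ} {p : ℕ} [hp : Fact p.Prime]


/-! ### §1 The EXACT-grade relation pins the regulator -/

omit hp in
/-- Two exact identities `x = u·(s·R·t) = u·(s·R'·t)` with `u, s, t ≠ 0` force `R = R'`. [folklore] -/
private theorem reg_eq_of_ids [Fact p.Prime] {u x s R R' t : ℚ_[p]} (hu : u ≠ 0) (hs : s ≠ 0)
    (ht : t ≠ 0) (h : x = u * (s * R * t)) (h' : x = u * (s * R' * t)) : R = R' := by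
  have h1 : s * R * t = s * R' * t := mul_left_cancel₀ hu (h.symm.trans h')
  have h2 : s * R = s * R' := mul_right_cancel₀ ht h1
  exact mul_left_cancel₀ hs h2

/-- **Two height data satisfying the EXACT census relation at the same admissible `(V, C, f, ϖ)` have
EQUAL regulators** (pointwise form: any twist model, good ordinary or multiplicative at `p`): the
unit `α♭⁻¹(·c_∞(E))` is pinned, `s = #Ш_an ≠ 0`, `∏c ≠ 0`. [cite: MazurTateTeitelbaum1986Invent, §I.13, §II.4] -/
theorem padicRegulator_eq_of_relationAt_of_relationAt_of_twist_model (hGZ : GrossZagier1986_thm_I_7_3)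
    (hGZK : rank_eq_analyticRank_of_analyticRank_le_one) {W : WeierstrassCurve ℚ} [W.IsElliptic]
    [W.IsGloballyMinimal] (hp2 : p ≠ 2) (hadd : Addv W p) (hr : W.analyticRank = 1)
    (V : WeierstrassCurve ℚ) [V.IsElliptic] [V.IsGloballyMinimal] (C : VariableChange ℚ)
    (hC : C • V.quadraticTwist ((-1 : ℚ) ^ (p / 2) * p) = W) (hV : IsOrdinaryAt V p ∨ Mult V p)
    {N : ℕ} [NeZero N] {f : CuspForm (Gamma0 N) 2} (hf : IsNewformOf V f) (ϖ : ℚ)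
    (hϖ : if Even (p / 2) then (ϖ : ℝ) * V.realPeriodRat = plusPeriod f
      else (ϖ : ℝ) * V.imaginaryPeriodRat = minusPeriod f)
    {Dh Dh' : PAdicHeightData W p} (h : RelationAt W p Dh) (h' : RelationAt W p Dh') :
    padicRegulator Dh = padicRegulator Dh' := by
  obtain ⟨s, hs0, hs⟩ := X11b.exists_rat_ne_zero_shaAn_eq_of_analyticRank_eq_one hGZ hGZK W hr
  have hgm : Good V p ∨ Mult V p := hV.imp_left fun h ↦ h.1
  obtain ⟨heven, hodd⟩ := h V C f hadd hgm hf hr s hs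
  obtain ⟨heven', hodd'⟩ := h' V C f hadd hgm hf hr s hs
  have hsp : (s : ℚ_[p]) ≠ 0 := by exact_mod_cast hs0
  have htam : (W.tamagawaProduct : ℚ_[p]) ≠ 0 := by
    exact_mod_cast (W.tamagawaProduct_pos_holds : 0 < W.tamagawaProduct).ne'
  have hodd4 : p % 4 = 1 ∨ p % 4 = 3 := by
    obtain ⟨k, hk⟩ := hp.out.odd_of_ne_two hp2
    omega
  rcases hodd4 with h1 | h3
  · have hev : Even (p / 2) := ⟨p / 4, by omega⟩
    have hC' : C • V.quadraticTwist (p : ℚ) = W := by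
      rw [pStar_eq_of_mod_four p (Or.inl h1), if_pos h1] at hC; exact hC
    rw [if_pos hev] at hϖ
    obtain ⟨hG, hM⟩ := heven h1 hC' ϖ hϖ
    obtain ⟨hG', hM'⟩ := heven' h1 hC' ϖ hϖ
    rcases hV with hord | hmult
    · obtain ⟨-, -, hid⟩ := hG hord
      obtain ⟨-, -, hid'⟩ := hG' hord
      obtain ⟨hu0, -⟩ := unitRoot_inv_ne_zero_and_valuation (p := p) V hord
      exact reg_eq_of_ids hu0 hsp htam hid hid'
    · obtain ⟨-, -, hid⟩ := hM hmult
      obtain ⟨-, -, hid'⟩ := hM' hmult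
      obtain ⟨hu0, -⟩ := intCast_LFunction_inv_ne_zero_and_valuation (p := p) hf hmult
      exact reg_eq_of_ids hu0 hsp htam hid hid'
  · have hnev : ¬ Even (p / 2) := by rw [Nat.not_even_iff_odd]; exact ⟨p / 4, by omega⟩
    have hC' : C • V.quadraticTwist (-(p : ℚ)) = W := by
      rw [pStar_eq_of_mod_four p (Or.inr h3), if_neg (by omega)] at hC; exact hC
    rw [if_neg hnev] at hϖ
    obtain ⟨hκ0, -⟩ := numRealComponents_cast_ne_zero_and_valuation (p := p) hp2 W
    obtain ⟨hG, hM⟩ := hodd h3 hC' ϖ hϖ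
    obtain ⟨hG', hM'⟩ := hodd' h3 hC' ϖ hϖ
    rcases hV with hord | hmult
    · obtain ⟨-, -, hid⟩ := hG hord
      obtain ⟨-, -, hid'⟩ := hG' hord
      obtain ⟨hu0, -⟩ := unitRoot_inv_ne_zero_and_valuation (p := p) V hord
      exact reg_eq_of_ids (mul_ne_zero hu0 hκ0) hsp htam hid hid'
    · obtain ⟨-, -, hid⟩ := hM hmult
      obtain ⟨-, -, hid'⟩ := hM' hmult
      obtain ⟨hu0, -⟩ := intCast_LFunction_inv_ne_zero_and_valuation (p := p) hf hmult
      exact reg_eq_of_ids (mul_ne_zero hu0 hκ0) hsp htam hid hid'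

/-- **(G-ord, `e = 2`) rows: the EXACT census relation pins `Reg_p(E, Dh)`** — `RelationAt W p Dh` and
`RelationAt W p Dh'` force `Reg_p(E,Dh) = Reg_p(E,Dh')` (the good ordinary twist model, its newform and
the period ratio are kernel theorems). So at exact grade the SIGN / unit of the height datum matters:
`RelationAt` holds for at most one datum in each class `{u · Dh : u ∈ ℤ_p^×}` with `Reg_p ≠ 0`.
[cite: MazurTateTeitelbaum1986Invent, §I.13, §II.4] -/
theorem padicRegulator_eq_of_relationAt_of_relationAt (hGZ : GrossZagier1986_thm_I_7_3)
    (hGZK : rank_eq_analyticRank_of_analyticRank_le_one)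
    (hmodD : nonempty_modularParametrizationData) {W : WeierstrassCurve ℚ} [W.IsElliptic]
    [W.IsGloballyMinimal] (hp2 : p ≠ 2) (hG : TypeGOrd W p) (hadd : Addv W p)
    (he : semistabilityIndex W p = 2) (hr : W.analyticRank = 1)
    {Dh Dh' : PAdicHeightData W p} (h : RelationAt W p Dh) (h' : RelationAt W p Dh') :
    padicRegulator Dh = padicRegulator Dh' := by
  obtain ⟨V, iV, iVm, C, hV, hC⟩ := TypeGOrd.exists_goodOrd_pStar_twist_model W p hp2 hG hadd he
  haveI : NeZero (V.conductorNorm ℤ) := ⟨(V.conductorNorm_pos_holds).ne'⟩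
  obtain ⟨Dm⟩ := hmodD V
  obtain ⟨ϖ, hϖ⟩ := exists_periodRatio_parity (p := p) V Dm
  exact padicRegulator_eq_of_relationAt_of_relationAt_of_twist_model hGZ hGZK hp2 hadd hr V C hC
    (Or.inl hV) Dm.isNewformOf ϖ hϖ h h'

/-- **(M) rows: the EXACT census relation pins `Reg_p(E, Dh)`** (`AdditivePotMult.PotMult W p`).
[cite: MazurTateTeitelbaum1986Invent, §I.13, §II.4] -/
theorem padicRegulator_eq_of_relationAt_of_relationAt_mult (hGZ : GrossZagier1986_thm_I_7_3)
    (hGZK : rank_eq_analyticRank_of_analyticRank_le_one)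
    (hmodD : nonempty_modularParametrizationData) {W : WeierstrassCurve ℚ} [W.IsElliptic]
    [W.IsGloballyMinimal] (hp2 : p ≠ 2) (hpm : AdditivePotMult.PotMult W p) (hr : W.analyticRank = 1)
    {Dh Dh' : PAdicHeightData W p} (h : RelationAt W p Dh) (h' : RelationAt W p Dh') :
    padicRegulator Dh = padicRegulator Dh' := by
  obtain ⟨V, iV, iVm, C, hV, hC⟩ := hpm.exists_mult_pStar_twist_model hp2
  haveI : NeZero (V.conductorNorm ℤ) := ⟨(V.conductorNorm_pos_holds).ne'⟩
  obtain ⟨Dm⟩ := hmodD V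
  obtain ⟨ϖ, hϖ⟩ := exists_periodRatio_parity (p := p) V Dm
  exact padicRegulator_eq_of_relationAt_of_relationAt_of_twist_model hGZ hGZK hp2 hpm.1 hr V C hC
    (Or.inr hV) Dm.isNewformOf ϖ hϖ h h'

/-! ### §2 The WINDOW-grade relation pins exactly the NORM of the regulator -/

omit hp in
/-- Two norm identities `‖x‖ = ‖s·R·t‖ = ‖s·R'·t‖` with `s, t ≠ 0` force `‖R‖ = ‖R'‖`. [folklore] -/
private theorem norm_reg_eq_of_ids [Fact p.Prime] {x s R R' t : ℚ_[p]} (hs : s ≠ 0) (ht : t ≠ 0)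
    (h : ‖x‖ = ‖s * R * t‖) (h' : ‖x‖ = ‖s * R' * t‖) : ‖R‖ = ‖R'‖ := by
  have h1 : ‖s‖ * ‖R‖ * ‖t‖ = ‖s‖ * ‖R'‖ * ‖t‖ := by
    rw [← norm_mul, ← norm_mul, ← h, h', norm_mul, norm_mul]
  exact mul_left_cancel₀ (norm_ne_zero_iff.mpr hs) (mul_right_cancel₀ (norm_ne_zero_iff.mpr ht) h1)

/-- **WINDOW grade pins exactly the NORM of the regulator** (pointwise form): two height data satisfying
`ValRelationAt` at the same admissible `(V, C, f, ϖ)` have `‖Reg_p(E,Dh)‖ = ‖Reg_p(E,Dh')‖` — and, by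
`valRelationAt_of_norm_padicRegulator_eq`, nothing finer is pinned.
[cite: Delbourgo1998, §2.5 BS-D(p) (i)(ii) (pp. 151–152) (shape only; nothing asserted)] -/
theorem norm_padicRegulator_eq_of_valRelationAt_of_valRelationAt_of_twist_model
    (hGZ : GrossZagier1986_thm_I_7_3) (hGZK : rank_eq_analyticRank_of_analyticRank_le_one)
    {W : WeierstrassCurve ℚ} [W.IsElliptic] [W.IsGloballyMinimal] (hp2 : p ≠ 2) (hadd : Addv W p)
    (hr : W.analyticRank = 1) (V : WeierstrassCurve ℚ) [V.IsElliptic] [V.IsGloballyMinimal]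
    (C : VariableChange ℚ) (hC : C • V.quadraticTwist ((-1 : ℚ) ^ (p / 2) * p) = W)
    (hV : IsOrdinaryAt V p ∨ Mult V p) {N : ℕ} [NeZero N] {f : CuspForm (Gamma0 N) 2}
    (hf : IsNewformOf V f) (ϖ : ℚ)
    (hϖ : if Even (p / 2) then (ϖ : ℝ) * V.realPeriodRat = plusPeriod f
      else (ϖ : ℝ) * V.imaginaryPeriodRat = minusPeriod f)
    {Dh Dh' : PAdicHeightData W p} (h : ValRelationAt W p Dh) (h' : ValRelationAt W p Dh') :
    ‖padicRegulator Dh‖ = ‖padicRegulator Dh'‖ := by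
  obtain ⟨s, hs0, hs⟩ := X11b.exists_rat_ne_zero_shaAn_eq_of_analyticRank_eq_one hGZ hGZK W hr
  have hgm : Good V p ∨ Mult V p := hV.imp_left fun h ↦ h.1
  obtain ⟨heven, hodd⟩ := h V C f hadd hgm hf hr s hs
  obtain ⟨heven', hodd'⟩ := h' V C f hadd hgm hf hr s hs
  have hsp : (s : ℚ_[p]) ≠ 0 := by exact_mod_cast hs0
  have htam : (W.tamagawaProduct : ℚ_[p]) ≠ 0 := by
    exact_mod_cast (W.tamagawaProduct_pos_holds : 0 < W.tamagawaProduct).ne'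
  have hodd4 : p % 4 = 1 ∨ p % 4 = 3 := by
    obtain ⟨k, hk⟩ := hp.out.odd_of_ne_two hp2
    omega
  rcases hodd4 with h1 | h3
  · have hev : Even (p / 2) := ⟨p / 4, by omega⟩
    have hC' : C • V.quadraticTwist (p : ℚ) = W := by
      rw [pStar_eq_of_mod_four p (Or.inl h1), if_pos h1] at hC; exact hC
    rw [if_pos hev] at hϖ
    obtain ⟨hG, hM⟩ := heven h1 hC' ϖ hϖ
    obtain ⟨hG', hM'⟩ := heven' h1 hC' ϖ hϖ
    rcases hV with hord | hmult
    · obtain ⟨-, -, hn⟩ := hG hord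
      obtain ⟨-, -, hn'⟩ := hG' hord
      exact norm_reg_eq_of_ids hsp htam hn hn'
    · obtain ⟨-, -, hn⟩ := hM hmult
      obtain ⟨-, -, hn'⟩ := hM' hmult
      exact norm_reg_eq_of_ids hsp htam hn hn'
  · have hnev : ¬ Even (p / 2) := by rw [Nat.not_even_iff_odd]; exact ⟨p / 4, by omega⟩
    have hC' : C • V.quadraticTwist (-(p : ℚ)) = W := by
      rw [pStar_eq_of_mod_four p (Or.inr h3), if_neg (by omega)] at hC; exact hC
    rw [if_neg hnev] at hϖ
    obtain ⟨hG, hM⟩ := hodd h3 hC' ϖ hϖ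
    obtain ⟨hG', hM'⟩ := hodd' h3 hC' ϖ hϖ
    rcases hV with hord | hmult
    · obtain ⟨-, -, hn⟩ := hG hord
      obtain ⟨-, -, hn'⟩ := hG' hord
      exact norm_reg_eq_of_ids hsp htam hn hn'
    · obtain ⟨-, -, hn⟩ := hM hmult
      obtain ⟨-, -, hn'⟩ := hM' hmult
      exact norm_reg_eq_of_ids hsp htam hn hn'

/-- **(G-ord, `e = 2`) rows: the WINDOW relation pins `‖Reg_p(E,Dh)‖`** (`ord_p Reg_p`), nothing finer.
[cite: Delbourgo1998, §2.5 BS-D(p) (i)(ii) (pp. 151–152) (shape only; nothing asserted)] -/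
theorem norm_padicRegulator_eq_of_valRelationAt_of_valRelationAt (hGZ : GrossZagier1986_thm_I_7_3)
    (hGZK : rank_eq_analyticRank_of_analyticRank_le_one)
    (hmodD : nonempty_modularParametrizationData) {W : WeierstrassCurve ℚ} [W.IsElliptic]
    [W.IsGloballyMinimal] (hp2 : p ≠ 2) (hG : TypeGOrd W p) (hadd : Addv W p)
    (he : semistabilityIndex W p = 2) (hr : W.analyticRank = 1)
    {Dh Dh' : PAdicHeightData W p} (h : ValRelationAt W p Dh) (h' : ValRelationAt W p Dh') :
    ‖padicRegulator Dh‖ = ‖padicRegulator Dh'‖ := by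
  obtain ⟨V, iV, iVm, C, hV, hC⟩ := TypeGOrd.exists_goodOrd_pStar_twist_model W p hp2 hG hadd he
  haveI : NeZero (V.conductorNorm ℤ) := ⟨(V.conductorNorm_pos_holds).ne'⟩
  obtain ⟨Dm⟩ := hmodD V
  obtain ⟨ϖ, hϖ⟩ := exists_periodRatio_parity (p := p) V Dm
  exact norm_padicRegulator_eq_of_valRelationAt_of_valRelationAt_of_twist_model hGZ hGZK hp2 hadd hr
    V C hC (Or.inl hV) Dm.isNewformOf ϖ hϖ h h'

/-- **(M) rows: the WINDOW relation pins `‖Reg_p(E,Dh)‖`.**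
[cite: Delbourgo1998, §2.5 BS-D(p) (i)(ii) (pp. 151–152) (shape only; nothing asserted)] -/
theorem norm_padicRegulator_eq_of_valRelationAt_of_valRelationAt_mult (hGZ : GrossZagier1986_thm_I_7_3)
    (hGZK : rank_eq_analyticRank_of_analyticRank_le_one)
    (hmodD : nonempty_modularParametrizationData) {W : WeierstrassCurve ℚ} [W.IsElliptic]
    [W.IsGloballyMinimal] (hp2 : p ≠ 2) (hpm : AdditivePotMult.PotMult W p) (hr : W.analyticRank = 1)
    {Dh Dh' : PAdicHeightData W p} (h : ValRelationAt W p Dh) (h' : ValRelationAt W p Dh') :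
    ‖padicRegulator Dh‖ = ‖padicRegulator Dh'‖ := by
  obtain ⟨V, iV, iVm, C, hV, hC⟩ := hpm.exists_mult_pStar_twist_model hp2
  haveI : NeZero (V.conductorNorm ℤ) := ⟨(V.conductorNorm_pos_holds).ne'⟩
  obtain ⟨Dm⟩ := hmodD V
  obtain ⟨ϖ, hϖ⟩ := exists_periodRatio_parity (p := p) V Dm
  exact norm_padicRegulator_eq_of_valRelationAt_of_valRelationAt_of_twist_model hGZ hGZK hp2 hpm.1 hr
    V C hC (Or.inr hV) Dm.isNewformOf ϖ hϖ h h'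

/-! ### §3 What the `∀ Dh` packaging adds at WINDOW grade -/

/-- **What the `∀ Dh` packaging asserts at WINDOW grade, beyond the relation for one datum:** on a
(G-ord, `e = 2`) row, if `∀ Dh, LeadingTermClauses W p Dh → ValRelationAt W p Dh`, then a (B)-datum
`Dh` and a rescaled datum `Dh'` (`⟨,⟩_{Dh'} = c·⟨,⟩_{Dh}`) that is AGAIN a (B)-datum have `‖c‖ = 1` — the
(B)-data of the row form a single unit class in norm. Where Delbourgo's factor `ℓ` is pinned to `1`
(`ReductionNonAnomalous W p`; every (M) row) Theorem (B) itself excludes `p · Dh` once the leading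
coefficient is non-zero; on the ANOMALOUS (G-ord) rows (`ℓ_p(E) ∈ {1, p, p²}`, J. Number Theory 95
(2002) p. 39) this is an extra, `ℓ_p(E)`-shaped rider of the packaging — consumers wanting none use the
pointwise forms (one `Dh` carrying both `hB` and `hrel`).
[cite: Delbourgo2002, Theorem (B) (p. 40) and p. 39 (ℓ_p(E))] -/
theorem norm_eq_one_of_forall_valRelationAt_of_leadingTermClauses_of_pairing_eq_mul
    (hGZ : GrossZagier1986_thm_I_7_3) (hGZK : rank_eq_analyticRank_of_analyticRank_le_one)
    (hmodD : nonempty_modularParametrizationData) {W : WeierstrassCurve ℚ} [W.IsElliptic]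
    [W.IsGloballyMinimal] (hp2 : p ≠ 2) (hG : TypeGOrd W p) (hadd : Addv W p)
    (he : semistabilityIndex W p = 2) (hr : W.analyticRank = 1)
    (hrel : ∀ Dh : PAdicHeightData W p, LeadingTermClauses W p Dh → ValRelationAt W p Dh)
    {Dh Dh' : PAdicHeightData W p} (hB : LeadingTermClauses W p Dh) {c : ℚ_[p]}
    (hc : ∀ P Q, Dh'.pairing P Q = c * Dh.pairing P Q) (hBc : LeadingTermClauses W p Dh') :
    ‖c‖ = 1 := by
  have hn := norm_padicRegulator_eq_of_valRelationAt_of_valRelationAt hGZ hGZK hmodD hp2 hG hadd he hr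
    (hrel _ hBc) (hrel Dh hB)
  have hS : padicRegulator Dh ≠ 0 := schneider_of_valRelationAt hGZ hGZK hmodD hp2 hG hadd he hr (hrel Dh hB)
  have hrk : W.mordellWeilRank = 1 := by rw [(hGZK W hr.le).1, hr]
  rw [padicRegulator_eq_of_pairing_eq_mul hc, hrk, pow_one, norm_mul] at hn
  have hR : ‖padicRegulator Dh‖ ≠ 0 := norm_ne_zero_iff.mpr hS
  exact mul_right_cancel₀ hR (hn.trans (one_mul _).symm)

/-- In particular, under the WINDOW-grade `∀ Dh` packaging on a (G-ord, `e = 2`) row, **`p · Dh` is never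
a (B)-datum when `Dh` is** (`‖p‖ = p⁻¹ < 1`). [cite: Delbourgo2002, Theorem (B) (p. 40) and p. 39 (ℓ_p(E))] -/
theorem not_leadingTermClauses_of_forall_valRelationAt_of_pairing_eq_prime_mul
    (hGZ : GrossZagier1986_thm_I_7_3) (hGZK : rank_eq_analyticRank_of_analyticRank_le_one)
    (hmodD : nonempty_modularParametrizationData) {W : WeierstrassCurve ℚ} [W.IsElliptic]
    [W.IsGloballyMinimal] (hp2 : p ≠ 2) (hG : TypeGOrd W p) (hadd : Addv W p)
    (he : semistabilityIndex W p = 2) (hr : W.analyticRank = 1)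
    (hrel : ∀ Dh : PAdicHeightData W p, LeadingTermClauses W p Dh → ValRelationAt W p Dh)
    {Dh Dh' : PAdicHeightData W p} (hB : LeadingTermClauses W p Dh)
    (hc : ∀ P Q, Dh'.pairing P Q = (p : ℚ_[p]) * Dh.pairing P Q) :
    ¬ LeadingTermClauses W p Dh' := fun hBc ↦ by
  have h1 := norm_eq_one_of_forall_valRelationAt_of_leadingTermClauses_of_pairing_eq_mul hGZ hGZK hmodD
    hp2 hG hadd he hr hrel hB hc hBc
  exact (Padic.norm_p_lt_one (p := p)).ne h1

end CensusX42

end Summit.BirchSwinnertonDyer.Rank1Residual.Additive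

end
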